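import Literature.MathematicalPhysics.QuantumLattice.HubbardBondPairDecaySharp
import Literature.MathematicalPhysics.QuantumLattice.GibbsFreeEnergyCouplingConcavity
import HarnessLib

/-!
# Koma–Tasaki's a priori bound in Peierls–Bogoliubov form: the cost of the complex gauge rotation
# is the THERMAL EXPECTATION of the hopping perturbation in the modulated Gibbs state, not its norm

Topic `Literature/MathematicalPhysics/QuantumLattice` (family `hubbard`; companion of
`HubbardBondPairDecaySharp.lean` and `HubbardHubbardModelPairDecayProofs.lean`). Koma–Tasaki
(PRL 68 (1992) 3248), proof of the Theorem, eqs. (6)–(11): with the non-unitary gauge transformation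
`G = exp[-Σ φ_u n_u]`, `G A G⁻¹ = κ A` and `G H G⁻¹ = H + U + iP` (`U` Hermitian), the chain
i) `|Tr[X Y]| ≤ ‖X‖ ‖Y‖₁`-type Schwarz, ii) Bernstein `Tr e^K e^{K†} ≤ Tr e^{K + K†}`,
iii) Golden–Thompson, iv) `‖e^{-βU}‖ ≤ e^{β‖U‖}` gives eq. (10)–(11),
`|⟨A⟩_β| ≤ |κ| ‖A‖ e^{β‖U‖}` — the tree's `norm_gibbsState_le_of_gauge` /
`koma_tasaki_trace_bound` (`TraceInequalitiesProofs`). Steps i)–ii) alone already give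

  `|Tr[A e^{-βH}]| ≤ |κ| ‖A‖ · Tr e^{-β(H+U)} = |κ| ‖A‖ · Z_β(H + U)`,                 (10′)

and the PEIERLS–BOGOLIUBOV inequality (Lieb 1973 §V; tree:
`mul_re_gibbsState_add_le_log_partitionFn_sub`, `GibbsFreeEnergyCouplingConcavity.lean`) bounds the
free-energy shift by the expectation of the perturbation IN THE PERTURBED STATE:
`log Z_β(H+U) − log Z_β(H) ≤ −β Re⟨U⟩_{β,H+U}`. Hence (this file):

* `norm_trace_mul_exp_le_re_trace_exp_hermitianPart` — (10′) in matrix form: for `H` Hermitian,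
  `‖A‖ ≤ 1` and any real `β`, `|Tr[A e^{-β(H+D)}]| ≤ Tr e^{-β(H+U)}`, `U = (D + Dᴴ)/2`;
* `norm_gibbsState_le_of_gauge_peierlsBogoliubov` — **`|⟨A⟩_{β,H}| ≤ |κ| ‖A‖ exp(−β Re⟨U⟩_{β,H+U})`**
  (`D A D⁻¹ = κA`, `D H D⁻¹ + (D H D⁻¹)ᴴ = 2(H+U)`); since `−Re⟨U⟩_{β,H+U} ≤ ‖U‖` this contains
  eq. (11), and it is STRICTLY BETTER whenever the perturbed Gibbs state does not saturate the norm;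
* `norm_thermalCorr_bondPair_le_exp_thermal` — the Hubbard instance for singlet bond pairs
  (footnote [10] of the source): for the grand-canonical Hubbard model `H = H(t,U) − μN` on a finite
  graph, every real `φ` and real `β`,
  `|⟨(b_{uv})† b_{wz}⟩_β| ≤ 4 e^{-(φ_u+φ_v)+(φ_w+φ_z)} exp(−β Re⟨V_φ⟩_{β, H + V_φ})`, where
  `V_φ = −t T(cosh(φ_a − φ_b) − 1)` (`hoppingForm`) is Koma–Tasaki's `U` of eq. (9) and
  `H + V_φ` is the Hubbard Hamiltonian whose hopping amplitude on the bond `ab` is MODULATED to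
  `t cosh(φ_a − φ_b)` (`hamiltonianWith_eq_hoppingForm`). The exponent
  `−β Re⟨V_φ⟩_{β,H+V_φ} = β t Σ_{a∼b} (cosh(φ_a−φ_b) − 1) Re⟨Σ_σ c†_{aσ} c_{bσ}⟩_{β,H+V_φ}` is the
  THERMAL BOND KINETIC ENERGY of the modulated model weighted by `cosh(∇φ) − 1 ≥ 0`, in place of
  the hopping NORM `|t| Σ_{a∼b}(cosh − 1)·1` of `norm_thermalCorr_bondPair_le_exp_sharp`;
* `norm_thermalCorr_bondPair_torus_le_rpow_of_thermalCost` — on `(ℤ/Lℤ)²`: if for some `b ≥ 0` the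
  thermal cost obeys `−β Re⟨V_φ⟩_{β,H+V_φ} ≤ b Σ_a Σ_c [a∼c](cosh(φ_a−φ_c) − 1)` for all potentials
  `φ` flat near `x` and `y` (a uniform ceiling `k̄` on the modulated thermal bond kinetic energies gives
  `b = β|t|k̄/2`; the norm gives `b = β|t|`), then
  `|⟨(b_{xx'})† b_{yy'}⟩_{β,L}| ≤ 4 K 5^f (dist(x,y)+1)^{-f}`, `f = 4q − 4πbq²`, uniformly in `L`
  (the tree's Euclidean log dipole, `le_rpow_euclid_of_apriori_flat`): the decay exponent improves
  from `1/(πβ|t|)` to `2/(πβ|t|k̄)`.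

Use (cell `pub/hubbard-tc`, crux №2 "sharp Koma–Tasaki with the kinetic/stiffness scale instead of the
hopping norm"): this file is the exact INTERFACE between that crux and a `T > 0` certifier — what has to
be certified is a ceiling on the thermal bond kinetic energies `Re⟨Σ_σ c†_{aσ}c_{bσ} + h.c.⟩_β` of Hubbard
models with bond-modulated hoppings `t cosh(∇φ)_{ab} ∈ [t, t cosh q₀]` (modulation `≤ cosh q₀ − 1`,
`q₀` the dipole's maximal gradient), uniformly over the family; any such certified `k̄ < 2` sharpens
the power law. HONEST FRAMING: no certificate and no number here; with the trivial `k̄ = 2` the file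
reproduces the tree's sharp bound, nothing more. The STIFFNESS (current–current corrected) scale is
NOT reached by this route: the cost is a kinetic-energy expectation (f-sum class).

References: T. Koma, H. Tasaki, PRL 68 (1992) 3248, eqs. (6)–(12), footnote [10]
[KomaTasakiPRL1992]; E. H. Lieb, CMP 31 (1973) 327, §V (5.2)–(5.4) (Peierls–Bogoliubov)
[Lieb1973]; D. Petz, Banach Center Publ. 30 (1994) 287, Thm 10 (Bernstein's inequality) [Petz1994];
O. A. McBryan, T. Spencer, CMP 53 (1977) 299 [McBryanSpencer1977].
-/

noncomputable section

namespace Literature.MathematicalPhysics.QuantumLattice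

open Matrix Finset NormedSpace Literature.Probability.LatticeModels
  Literature.Barriers.HubbardSuperconductivity
open scoped Matrix.Norms.L2Operator ComplexOrder

/-! ### Matrix form: Schwarz + Bernstein, stopping before Golden–Thompson -/

section MatrixForm

variable {n : Type*} [Fintype n] [DecidableEq n]

/-- **Koma–Tasaki (10) without Golden–Thompson**: for `H` Hermitian, any `D`, any real `β` and
`‖A‖ ≤ 1`, `|Tr[A e^{-β(H+D)}]| ≤ Tr e^{-β(H+U)}` with `U = (D + Dᴴ)/2` (Schwarz for the trace and
Bernstein's `Tr e^X e^{Xᴴ} ≤ Tr e^{X+Xᴴ}`, `X = -β(H+D)/2`).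
[cite: KomaTasakiPRL1992, eq. (10) steps i)–ii)] -/
theorem norm_trace_mul_exp_le_re_trace_exp_hermitianPart [Nonempty n] {H D A : Matrix n n ℂ}
    (hH : H.IsHermitian) (β : ℝ) (hA : ‖A‖ ≤ 1) :
    ‖(A * exp (-(β : ℂ) • (H + D))).trace‖ ≤
      (exp (-(β : ℂ) • (H + (2 : ℂ)⁻¹ • (D + Dᴴ)))).trace.re := by
  set U : Matrix n n ℂ := (2 : ℂ)⁻¹ • (D + Dᴴ) with hU
  set b : ℂ := -((β / 2 : ℝ) : ℂ) with hb
  have hbb : b + b = -(β : ℂ) := by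
    rw [hb]
    push_cast
    ring
  -- (10): Schwarz + ii)
  have h10 := norm_trace_mul_exp_le_re_trace (H + D) A hA b
  rw [hbb] at h10
  -- Bernstein: Tr[e^X e^{Xᴴ}] ≤ Tr[e^{X + Xᴴ}], X = b(H + D), X + Xᴴ = -βH + -βU
  set X : Matrix n n ℂ := b • (H + D) with hX
  have hXX : X + Xᴴ = -(β : ℂ) • H + -(β : ℂ) • U := by
    have hbstar : star b = b := by
      rw [hb, star_neg, Complex.star_def, Complex.conj_ofReal]
    rw [hX, hU, conjTranspose_smul, hbstar, conjTranspose_add, hH.eq, hb]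
    ext i j
    simp only [Matrix.add_apply, Matrix.smul_apply, smul_eq_mul]
    push_cast
    ring
  have hBern := bernstein_trace_exp_mul_exp_conjTranspose_le_holds X
  rw [hXX] at hBern
  calc ‖(A * exp (-(β : ℂ) • (H + D))).trace‖
      ≤ (exp X * (exp X)ᴴ).trace.re := h10
    _ = RCLike.re (exp X * exp Xᴴ).trace := by rw [exp_conjTranspose]; rfl
    _ ≤ RCLike.re (exp (-(β : ℂ) • H + -(β : ℂ) • U)).trace := hBern
    _ = (exp (-(β : ℂ) • (H + U))).trace.re := by rw [← smul_add]; rfl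

/-- **Koma–Tasaki's a priori bound in Peierls–Bogoliubov form.** `H` Hermitian, `D` invertible with
`D A D⁻¹ = κ A` and `D H D⁻¹ + (D H D⁻¹)ᴴ = 2(H + V)` (so `V` is the Hermitian part `U` of eq. (9));
then for every real `β`,

  `|⟨A⟩_{β,H}| ≤ |κ| ‖A‖ exp(−β Re⟨V⟩_{β, H+V})`.

(Eq. (6): `Tr[A e^{-βH}] = κ Tr[A e^{-β D H D⁻¹}]`; (10′): `≤ |κ|‖A‖ Z_β(H+V)`; Peierls–Bogoliubov:
`Z_β(H+V) ≤ Z_β(H) exp(−β Re⟨V⟩_{β,H+V})`.) Since `−Re⟨V⟩_{β,H+V} ≤ ‖V‖`, this implies eq. (11)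
(`norm_gibbsState_le_of_gauge`). [cite: KomaTasakiPRL1992, eqs. (6), (10), (11)] [cite: Lieb1973, §V (5.2)–(5.4)] -/
theorem norm_gibbsState_le_of_gauge_peierlsBogoliubov [Nonempty n] {H A D V : Matrix n n ℂ}
    (hH : H.IsHermitian) (hD : IsUnit D) {κ : ℂ} (hA : D * A * D⁻¹ = κ • A)
    (hV : D * H * D⁻¹ + (D * H * D⁻¹)ᴴ = (2 : ℂ) • (H + V)) (β : ℝ) :
    ‖gibbsState β H A‖ ≤ ‖κ‖ * ‖A‖ * Real.exp (-(β * (gibbsState β (H + V) V).re)) := by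
  -- `V` is Hermitian: `H + V = ½ (K + Kᴴ)`
  set K : Matrix n n ℂ := D * H * D⁻¹ with hK
  have hHV : (H + V).IsHermitian := by
    have h2 : H + V = (((2 : ℝ)⁻¹ : ℝ) : ℂ) • (K + Kᴴ) := by
      rw [hV, smul_smul]
      push_cast
      rw [inv_mul_cancel₀ two_ne_zero, one_smul]
    rw [h2]
    exact isHermitian_real_smul (Matrix.isHermitian_add_transpose_self K) _
  have hVh : V.IsHermitian := by
    have := hHV.sub hH
    rwa [add_sub_cancel_left] at this
  -- the gauge transformation as a unit and eq. (6)
  set G : (Matrix n n ℂ)ˣ := hD.unit with hG_def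
  have hG : (G : Matrix n n ℂ) = D := hD.unit_spec
  have hGinv : ((G⁻¹ : (Matrix n n ℂ)ˣ) : Matrix n n ℂ) = D⁻¹ := by
    rw [Matrix.coe_units_inv, hG]
  set D' : Matrix n n ℂ := K - H with hD'
  have hGH : (G : Matrix n n ℂ) * H * ((G⁻¹ : (Matrix n n ℂ)ˣ) : Matrix n n ℂ) = H + D' := by
    rw [hG, hGinv, hD', add_sub_cancel]
  have hU : (2 : ℂ)⁻¹ • (D' + D'ᴴ) = V := by
    rw [hD', conjTranspose_sub, hH.eq,
      show K - H + (Kᴴ - H) = (K + Kᴴ) - (2 : ℂ) • H by rw [two_smul]; abel, hV, ← smul_sub,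
      add_sub_cancel_left, smul_smul, inv_mul_cancel₀ two_ne_zero, one_smul]
  -- normalise the observable
  by_cases hA0 : A = 0
  · subst hA0
    simp
  have hApos : 0 < ‖A‖ := norm_pos_iff.2 hA0
  set A' : Matrix n n ℂ := ((‖A‖⁻¹ : ℝ) : ℂ) • A with hA'
  have hA'1 : ‖A'‖ ≤ 1 := by
    rw [hA', norm_smul, Complex.norm_real, Real.norm_of_nonneg (inv_nonneg.2 hApos.le),
      inv_mul_cancel₀ hApos.ne']
  have hGA' : (G : Matrix n n ℂ) * A' * ((G⁻¹ : (Matrix n n ℂ)ˣ) : Matrix n n ℂ) = κ • A' := by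
    rw [hA', Matrix.mul_smul, Matrix.smul_mul, hG, hGinv, hA, smul_comm]
  have hAA' : A = ((‖A‖ : ℝ) : ℂ) • A' := by
    rw [hA', smul_smul, ← Complex.ofReal_mul, mul_inv_cancel₀ hApos.ne', Complex.ofReal_one,
      one_smul]
  -- eq. (6): Tr[A' e^{-βH}] = κ Tr[A' e^{-β(H + D')}]
  have hconjExp : (G : Matrix n n ℂ) * exp (-(β : ℂ) • H) * ((G⁻¹ : (Matrix n n ℂ)ˣ) : Matrix n n ℂ) =
      exp (-(β : ℂ) • (H + D')) := by
    rw [← Matrix.exp_units_conj, Matrix.mul_smul, Matrix.smul_mul, hGH]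
  have h6 : (A' * exp (-(β : ℂ) • H)).trace = κ * (A' * exp (-(β : ℂ) • (H + D'))).trace := by
    calc (A' * exp (-(β : ℂ) • H)).trace
        = ((G : Matrix n n ℂ) * (A' * exp (-(β : ℂ) • H)) *
            ((G⁻¹ : (Matrix n n ℂ)ˣ) : Matrix n n ℂ)).trace := (trace_units_conj G _).symm
      _ = (((G : Matrix n n ℂ) * A' * ((G⁻¹ : (Matrix n n ℂ)ˣ) : Matrix n n ℂ)) *
            ((G : Matrix n n ℂ) * exp (-(β : ℂ) • H) *
              ((G⁻¹ : (Matrix n n ℂ)ˣ) : Matrix n n ℂ))).trace := by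
          congr 1
          simp only [Matrix.mul_assoc, Units.inv_mul_cancel_left]
      _ = κ * (A' * exp (-(β : ℂ) • (H + D'))).trace := by
          rw [hGA', hconjExp, Matrix.smul_mul, trace_smul, smul_eq_mul]
  -- (10′): `|Tr[A' e^{-β(H+D')}]| ≤ Z_β(H+V)`
  have h10 := norm_trace_mul_exp_le_re_trace_exp_hermitianPart (D := D') hH β hA'1
  rw [hU] at h10
  -- partition functions as positive reals
  have hZ : 0 < partitionFn β H := partitionFn_pos β hH
  have hZre : 0 < (partitionFn β H).re := (Complex.pos_iff.mp hZ).1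
  have hZ' : 0 < partitionFn β (H + V) := partitionFn_pos β hHV
  have hZ're : 0 < (partitionFn β (H + V)).re := (Complex.pos_iff.mp hZ').1
  have hZeq : partitionFn β H = ((partitionFn β H).re : ℂ) := by
    apply Complex.ext <;> simp [← (Complex.pos_iff.mp hZ).2]
  have hnormZ : ‖partitionFn β H‖ = (partitionFn β H).re := by
    rw [hZeq, Complex.norm_real, Real.norm_of_nonneg hZre.le, Complex.ofReal_re]
  have hw : gibbsWeight β H = exp (-((β : ℂ) • H)) := by rw [gibbsWeight, neg_smul]
  have hw' : (exp (-(β : ℂ) • (H + V))).trace.re = (partitionFn β (H + V)).re := by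
    rw [partitionFn, gibbsWeight]
  -- Peierls–Bogoliubov: `Z(H+V) ≤ Z(H) exp(-β Re⟨V⟩_{H+V})`
  have hPB : (partitionFn β (H + V)).re ≤
      (partitionFn β H).re * Real.exp (-(β * (gibbsState β (H + V) V).re)) := by
    have h := mul_re_gibbsState_add_le_log_partitionFn_sub hH hVh β
    have h1 : Real.log (partitionFn β (H + V)).re ≤
        Real.log (partitionFn β H).re + -(β * (gibbsState β (H + V) V).re) := by linarith
    calc (partitionFn β (H + V)).re = Real.exp (Real.log (partitionFn β (H + V)).re) :=
          (Real.exp_log hZ're).symm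
      _ ≤ Real.exp (Real.log (partitionFn β H).re + -(β * (gibbsState β (H + V) V).re)) :=
          Real.exp_le_exp.2 h1
      _ = (partitionFn β H).re * Real.exp (-(β * (gibbsState β (H + V) V).re)) := by
          rw [Real.exp_add, Real.exp_log hZre]
  -- assemble
  have htr : (gibbsWeight β H * A).trace = (A * exp (-((β : ℂ) • H))).trace := by
    rw [hw, trace_mul_comm]
  rw [gibbsState_apply, norm_mul, norm_inv, hnormZ, inv_mul_le_iff₀ hZre, htr]
  calc ‖(A * exp (-((β : ℂ) • H))).trace‖ = ‖A‖ * ‖(A' * exp (-(β : ℂ) • H)).trace‖ := by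
        conv_lhs => rw [hAA']
        rw [Matrix.smul_mul, trace_smul, norm_smul, Complex.norm_real, Real.norm_of_nonneg hApos.le,
          neg_smul]
    _ = ‖A‖ * (‖κ‖ * ‖(A' * exp (-(β : ℂ) • (H + D'))).trace‖) := by rw [h6, norm_mul]
    _ ≤ ‖A‖ * (‖κ‖ * (partitionFn β (H + V)).re) := by
        rw [← hw']
        gcongr
    _ ≤ ‖A‖ * (‖κ‖ * ((partitionFn β H).re * Real.exp (-(β * (gibbsState β (H + V) V).re)))) := by
        gcongr
    _ = (partitionFn β H).re * (‖κ‖ * ‖A‖ * Real.exp (-(β * (gibbsState β (H + V) V).re))) := by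
        ring

end MatrixForm

/-! ### The Hubbard instance: singlet bond pairs, thermal cost of the modulated model -/

section Graph

variable {Λ : Type*} [LinearOrder Λ] [Fintype Λ] (G : SimpleGraph Λ) [DecidableRel G.Adj]

/-- Koma–Tasaki's Hermitian perturbation `U` of eq. (9) for the rotation field `φ`:
`V_φ = −t T(cosh(φ_a − φ_b) − 1)`, so that `H + V_φ` is the Hubbard Hamiltonian with the bond
hoppings modulated to `t cosh(φ_a − φ_b)`. [cite: KomaTasakiPRL1992, eqs. (7) and (9)] -/
def gaugeCost (t : ℝ) (φ : Λ → ℝ) : Matrix (Finset (Orb Λ)) (Finset (Orb Λ)) ℂ :=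
  -(t : ℂ) • hoppingForm G (fun a b => Real.cosh (φ a - φ b) - 1)

/-- **The modulated model**: `H + V_φ = −t T(cosh(φ_a − φ_b)) + (U, μ terms)` — the Hubbard
Hamiltonian with the bond hoppings modulated from `t` to `t cosh(φ_a − φ_b)`.
[cite: KomaTasakiPRL1992, eqs. (7) and (9)] -/
theorem hamiltonianWith_add_gaugeCost (t U μ : ℝ) (φ : Λ → ℝ) :
    hamiltonianWith G t U μ + gaugeCost G t φ =
      -(t : ℂ) • hoppingForm G (fun a b => Real.cosh (φ a - φ b)) + densityTerms U μ := by
  rw [gaugeCost, hamiltonianWith_eq_hoppingForm, add_right_comm, ← smul_add, hoppingForm_add]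
  congr 3
  funext a b
  ring

/-- **Koma–Tasaki's a priori bound for bond pairs with the THERMAL cost** (eqs. (6)–(10), footnote
[10], with Peierls–Bogoliubov in place of `‖e^{-βU}‖ ≤ e^{β‖U‖}`): on an arbitrary finite graph, for
every real site function `φ`, every real `β` and sites `u, v, w, z`,
`|⟨(b_{uv})† b_{wz}⟩_β| ≤ 4 exp[-(φ_u+φ_v)+(φ_w+φ_z)] exp[−β Re⟨V_φ⟩_{β, H+V_φ}]`, where
`−β Re⟨V_φ⟩_{β,H+V_φ} = βt Σ_{a∼b}(cosh(φ_a−φ_b) − 1) Re⟨Σ_σ c†_{aσ}c_{bσ}⟩_{β,H+V_φ}` is the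
`(cosh∇φ − 1)`-weighted thermal bond kinetic energy of the modulated model.
[cite: KomaTasakiPRL1992, eqs. (6)–(10) and footnote [10]] [cite: Lieb1973, §V (5.2)–(5.4)] -/
theorem norm_thermalCorr_bondPair_le_exp_thermal (t U μ β : ℝ) (φ : Λ → ℝ) (u v w z : Λ) :
    ‖(hamiltonianWith G t U μ).thermalCorr β (bondPair u v)ᴴ (bondPair w z)‖ ≤
      4 * Real.exp (-(φ u + φ v) + (φ w + φ z)) *
        Real.exp (-(β * (gibbsState β (hamiltonianWith G t U μ + gaugeCost G t φ)
          (gaugeCost G t φ)).re)) := by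
  set H : Matrix (Finset (Orb Λ)) (Finset (Orb Λ)) ℂ := hamiltonianWith G t U μ with hH_def
  set A : Matrix (Finset (Orb Λ)) (Finset (Orb Λ)) ℂ := (bondPair u v)ᴴ * bondPair w z
    with hA_def
  set V : Matrix (Finset (Orb Λ)) (Finset (Orb Λ)) ℂ := gaugeCost G t φ with hV_def
  set κ : ℝ := Real.exp (-(φ u + φ v) + (φ w + φ z)) with hκ_def
  have hH : H.IsHermitian := isHermitian_hamiltonianWith G t U μ
  have hD : IsUnit (siteGauge φ) := isUnit_siteGauge φ
  have hA : siteGauge φ * A * (siteGauge φ)⁻¹ = ((κ : ℝ) : ℂ) • A := by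
    rw [siteGauge_inv]
    exact siteGauge_mul_bondPairCorr_mul φ u v w z
  have hV : siteGauge φ * H * (siteGauge φ)⁻¹ + (siteGauge φ * H * (siteGauge φ)⁻¹)ᴴ =
      (2 : ℂ) • (H + V) := by
    rw [siteGauge_inv]
    exact siteGauge_conj_hamiltonianWith_add_conjTranspose G φ t U μ
  have h := norm_gibbsState_le_of_gauge_peierlsBogoliubov hH hD hA hV β
  have hκ : ‖((κ : ℝ) : ℂ)‖ = κ := by
    rw [Complex.norm_real, Real.norm_of_nonneg (Real.exp_pos _).le]
  have hthermal : H.thermalCorr β (bondPair u v)ᴴ (bondPair w z) = gibbsState β H A := rfl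
  rw [hthermal]
  calc ‖gibbsState β H A‖
      ≤ ‖((κ : ℝ) : ℂ)‖ * ‖A‖ * Real.exp (-(β * (gibbsState β (H + V) V).re)) := h
    _ ≤ ‖((κ : ℝ) : ℂ)‖ * 4 * Real.exp (-(β * (gibbsState β (H + V) V).re)) := by
        gcongr
        exact norm_bondPairCorr_le_four u v w z
    _ = 4 * κ * Real.exp (-(β * (gibbsState β (H + V) V).re)) := by rw [hκ]; ring

/-- **The thermal cost never exceeds the norm cost**: `−Re⟨V_φ⟩_{β,H+V_φ} ≤ ‖V_φ‖ ≤
|t| Σ_a Σ_b [a∼b] (cosh(φ_a − φ_b) − 1)`, so `norm_thermalCorr_bondPair_le_exp_thermal` contains the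
printed bound `norm_thermalCorr_bondPair_le_exp_sharp`. [cite: KomaTasakiPRL1992, eq. (11) (first bound)] -/
theorem neg_re_gibbsState_gaugeCost_le (t U μ β : ℝ) (φ : Λ → ℝ) :
    -(gibbsState β (hamiltonianWith G t U μ + gaugeCost G t φ) (gaugeCost G t φ)).re ≤
      |t| * ∑ a : Λ, ∑ b : Λ, (if G.Adj a b then (Real.cosh (φ a - φ b) - 1) else 0) := by
  have hH : (hamiltonianWith G t U μ).IsHermitian := isHermitian_hamiltonianWith G t U μ
  have hw : ∀ a b, (Real.cosh (φ a - φ b) - 1) = (Real.cosh (φ b - φ a) - 1) := fun a b => by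
    rw [← Real.cosh_neg, neg_sub]
  have hVh : (gaugeCost G t φ).IsHermitian := by
    unfold gaugeCost
    have h := isHermitian_hoppingForm G (w := fun a b => Real.cosh (φ a - φ b) - 1) hw
    have := isHermitian_real_smul h (-t)
    rwa [Complex.ofReal_neg] at this
  have hnorm : ‖gaugeCost G t φ‖ ≤
      |t| * ∑ a : Λ, ∑ b : Λ, (if G.Adj a b then (Real.cosh (φ a - φ b) - 1) else 0) :=
    norm_hoppingPerturbation_le_sharp G φ t
  refine le_trans ?_ hnorm
  refine le_trans (neg_le_abs _) ?_
  refine (Complex.abs_re_le_norm _).trans ?_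
  exact norm_gibbsState_le (hH.add hVh) β _

end Graph

/-! ### Torus: flat potentials and the power law under a thermal-cost hypothesis -/

section Torus

variable {L : ℕ} [NeZero L]

/-- **The thermal a priori bound on `(ℤ/Lℤ)²` for flat potentials**: if `φ` takes the same value at
`x'` as at `x` and at `y'` as at `y`, then for every real `β`
`|⟨(b_{xx'})† b_{yy'}⟩_{β,L}| ≤ 4 e^{-2(φ_x - φ_y)} exp[−β Re⟨V_φ⟩_{β,H+V_φ}]` (gauge charge `2`).
[cite: KomaTasakiPRL1992, eqs. (6)–(10) and footnote [10]] -/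
theorem norm_thermalCorr_bondPair_torus_le_exp_thermal (t U μ β : ℝ)
    (φ : TorusSite 2 L → ℝ) (x x' y y' : TorusSite 2 L) (hx' : φ x' = φ x) (hy' : φ y' = φ y) :
    ‖(hubbardTorusWith 2 L t U μ).thermalCorr β
        (bondPair (FermionTorus.ofTorusSite x) (FermionTorus.ofTorusSite x'))ᴴ
        (bondPair (FermionTorus.ofTorusSite y) (FermionTorus.ofTorusSite y'))‖ ≤
      4 * (Real.exp (-(2 * (φ x - φ y))) *
        Real.exp (-(β * (gibbsState β
          (hamiltonianWith (fermionTorusGraph 2 L) t U μ +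
            gaugeCost (fermionTorusGraph 2 L) t (fun u => φ (FermionTorus.toTorusSite u)))
          (gaugeCost (fermionTorusGraph 2 L) t (fun u => φ (FermionTorus.toTorusSite u)))).re))) := by
  have key := norm_thermalCorr_bondPair_le_exp_thermal (fermionTorusGraph 2 L) t U μ β
    (fun u => φ (FermionTorus.toTorusSite u)) (FermionTorus.ofTorusSite x)
    (FermionTorus.ofTorusSite x') (FermionTorus.ofTorusSite y) (FermionTorus.ofTorusSite y')
  simp only [FermionTorus.toTorusSite_ofTorusSite] at key
  rw [hx', hy'] at key
  have h2 : -(φ x + φ x) + (φ y + φ y) = -(2 * (φ x - φ y)) := by ring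
  rw [h2, mul_assoc] at key
  convert key using 20
  unfold hubbardTorusWith
  congr!

/-- **Power-law decay from a THERMAL cost bound** (the crux-№2 interface). Suppose that for some
`b ≥ 0` the thermal cost of every potential `φ` flat near `x` and `y` is bounded by the dipole energy,
`−β Re⟨V_φ⟩_{β,H+V_φ} ≤ b Σ_a Σ_c [a∼c] (cosh(φ_a − φ_c) − 1)` (e.g. `b = β|t|k̄/2` from a uniform
ceiling `k̄` on the thermal bond kinetic energies `Re⟨Σ_σ c†_{aσ}c_{cσ} + h.c.⟩` of the modulated
models; `b = β|t|` always, by `neg_re_gibbsState_gaugeCost_le`). Then for every `q ≥ 0` with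
`f := 4q − 4πbq² ≥ 0` and partner sites `x', y'` with `|x'−x|₂², |y'−y|₂² ≤ 1`:
`|⟨(b_{xx'})† b_{yy'}⟩_{β,L}| ≤ 4 K 5^f (dist(x,y)+1)^{-f}`, `K = exp[2b(2πq² + 76q² + 544q⁴e^{2q²})]`,
uniformly in `L`; at `q = 1/(2πb)`, `f = 1/(πb)`. [cite: KomaTasakiPRL1992, Theorem eq. (2), footnote [10], eqs. (5)–(13)] -/
theorem norm_thermalCorr_bondPair_torus_le_rpow_of_thermalCost (L : ℕ) [NeZero L]
    (t U μ β b q : ℝ) (hb : 0 ≤ b) (hq : 0 ≤ q) (hf : 0 ≤ 4 * q - 4 * Real.pi * b * q ^ 2)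
    (x x' y y' : TorusSite 2 L) (hx' : torusNormSq (x' - x) ≤ 1) (hy' : torusNormSq (y' - y) ≤ 1)
    (hcost : ∀ φ : TorusSite 2 L → ℝ, (∀ u, torusNormSq (u - x) ≤ 1 → φ u = φ x) →
      (∀ v, torusNormSq (v - y) ≤ 1 → φ v = φ y) →
      -(β * (gibbsState β
          (hamiltonianWith (fermionTorusGraph 2 L) t U μ +
            gaugeCost (fermionTorusGraph 2 L) t (fun u => φ (FermionTorus.toTorusSite u)))
          (gaugeCost (fermionTorusGraph 2 L) t (fun u => φ (FermionTorus.toTorusSite u)))).re) ≤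
        b * ∑ a : TorusSite 2 L, ∑ c : TorusSite 2 L,
          (if (torusGraph 2 L).Adj a c then (Real.cosh (φ a - φ c) - 1) else 0)) :
    ‖(hubbardTorusWith 2 L t U μ).thermalCorr β
        (bondPair (FermionTorus.ofTorusSite x) (FermionTorus.ofTorusSite x'))ᴴ
        (bondPair (FermionTorus.ofTorusSite y) (FermionTorus.ofTorusSite y'))‖ ≤
      4 * (Real.exp (2 * b * (2 * Real.pi * q ^ 2 + 76 * q ^ 2 + 544 * q ^ 4 * Real.exp (2 * q ^ 2))) *
        ((5 : ℝ) ^ (4 * q - 4 * Real.pi * b * q ^ 2) *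
          ((torusDist x y : ℝ) + 1) ^ (-(4 * q - 4 * Real.pi * b * q ^ 2)))) := by
  set g : ℝ := ‖(hubbardTorusWith 2 L t U μ).thermalCorr β
        (bondPair (FermionTorus.ofTorusSite x) (FermionTorus.ofTorusSite x'))ᴴ
        (bondPair (FermionTorus.ofTorusSite y) (FermionTorus.ofTorusSite y'))‖ with hg
  have h4 : g / 4 ≤ Real.exp (2 * b * (2 * Real.pi * q ^ 2 + 76 * q ^ 2 + 544 * q ^ 4 * Real.exp (2 * q ^ 2))) *
        ((5 : ℝ) ^ (4 * q - 4 * Real.pi * b * q ^ 2) *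
          ((torusDist x y : ℝ) + 1) ^ (-(4 * q - 4 * Real.pi * b * q ^ 2))) := by
    refine le_rpow_euclid_of_apriori_flat L b 2 q (g / 4) _ hb hq x y (fun φ hfx hfy => ?_) (by ring) hf
    rw [div_le_iff₀ (by norm_num : (0 : ℝ) < 4)]
    have h1 := norm_thermalCorr_bondPair_torus_le_exp_thermal t U μ β φ x x' y y' (hfx x' hx') (hfy y' hy')
    have h2 := Real.exp_le_exp.2 (hcost φ hfx hfy)
    calc g ≤ _ := h1
      _ ≤ 4 * (Real.exp (-(2 * (φ x - φ y))) * Real.exp (b * ∑ a : TorusSite 2 L, ∑ c : TorusSite 2 L,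
            (if (torusGraph 2 L).Adj a c then (Real.cosh (φ a - φ c) - 1) else 0))) := by
          gcongr
      _ = _ := by ring
  linarith

end Torus

end Literature.MathematicalPhysics.QuantumLattice
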